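import Summits.HodgeConjecture.CorCM.MumfordTateRankSixSplitting
import Summits.HodgeConjecture.CorCM.MumfordTateRankFourFactorDimension
import Literature.AlgebraicGeometry.Milne1999.CMTypeSimpleIsogenyFactors
import Literature.AlgebraicGeometry.Motives.AbelianVarietyProductIsogeny
import HarnessLib

/-!
# The rungs `dim MT(H¹(X)) ≤ 6` of the Mumford–Tate rank ladder for complex abelian varieties NOT of CM type, III:
# the isogeny classification `X ∼ B^{m+1} × Z`, `B` a non-CM elliptic curve or QM surface, `Z` of CM type

COR-CM (cell `pub-hodgecm2`, seat `b27` gen 37, count-neutral lane MT-RANK-SIX-ISOGENY; theorems only, no definition,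
no named fact; UNCONDITIONAL — nothing here uses or asserts HC_CM).  Sequel of `CorCM/MumfordTateRankSixSplitting`
(`X ∼ Y × Z` along the central idempotent `e`, `Z` of CM type, `Y` not; `h : X → Y`, `i : Y → X`, `i h = [M]_Y`,
`h i = F`, `F = M e` in `End⁰ X`).

§1 is pure algebra over any field: along such a quasi-retraction the `ℚ`-linear map
`θ = endConjLin i h : End⁰(Y) → End⁰(X)`, `w' ↦ i ∘ w' ∘ h`, is injective, multiplicative up to `M`
(`θ(x) θ(y) = M θ(xy)`, `θ(1) = M e`) and has image EXACTLY the corner `e End⁰(X) = {w : e w = w}`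
(`corner_transport`); so `dim_ℚ End⁰(Y) = dim_ℚ e End⁰(X)` and the centre of `End⁰(Y)` is `ℚ` as soon as the centre of
the corner is `ℚ e` (`center_eq_bot_of_corner`).

§2 feeds this with the corner data of `CorCM/MumfordTateRankSixCenter` (`4 · dim (e End⁰ X) = (rk e^*)²`, centre of the
corner `= ℚ e`) and `rk e^* = dim H¹(Y) = 2 dim Y` (`h^*` is injective with image `e^* H¹(X)`):
`dim_ℚ End⁰(Y) = (dim Y)²`, `Z(End⁰ Y) = ℚ`, hence (`exists_isIsogenous_power_of_finrank_center_eq_one`, gen 30)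
`Y ∼ B^{m+1}` with `B` simple, `dim_ℚ End⁰(B) = (dim B)²`, so `dim B ≤ 2` (`dim_le_two_of_finrank_endAlgebra_eq_sq`) and
`B` is not of CM type:

* **`exists_isIsogenous_powSucc_prod_of_finrank_derived_eq_three`** (every `X` with `0 < dim X` and
  `dim [Lie Hg(H¹X), Lie Hg(H¹X)] = 3`: Hodge group of semisimple rank one, any centre) and its special case
  **`exists_isIsogenous_powSucc_prod_of_mtRank_le_six`** (`X` not CM, `dim MT(H¹X) ≤ 6`) — `X ∼ B^{m+1} × Z`, `B` simple of dimension `1` or `2`, NOT of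
  CM type, `dim_ℚ End⁰(B) = (dim B)²`, `Z(End⁰ B) = ℚ`; `Z` of CM type; `(m+1) dim B + dim Z = dim X`; and
  `dim Z = 0 ↔ dim MT(H¹X) = 4`.
* `exists_isIsogenous_powSucc_prod_dim_le_two_of_finrank_derived_eq_three` / `…_of_mtRank_le_six` — the same with the
  dichotomy spelled out: `B` a non-CM
  elliptic curve (`End⁰(B) = ℚ`) or an abelian surface with `End⁰(B)` a non-commutative central `ℚ`-algebra of
  dimension `4` (quaternionic multiplication).

This is Moonen–Zarhin's description of the abelian varieties whose Hodge group has semisimple rank one read through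
the Mumford–Tate rank: `dim MT(H¹X) = 4 + dim Z(Lie Hg)` (`CorCM/MumfordTateRankSix`), the semisimple part `𝔰𝔩₂` acting
through `Y`, the centre through the CM part `Z`.

## References

* [MoonenZarhin1999LowDim] B. Moonen, Yu. Zarhin, *Hodge classes on abelian varieties of low dimension*, Math. Ann.
  315 (1999), §2 (2.1)–(2.5).
* [MumfordAV1970] D. Mumford, *Abelian Varieties* (1970), §19 Thm. 1, Cor. 1–2 (pp. 173–174), Remark p. 169, Thm. 3.
* [Deligne1982HodgeCycles] P. Deligne, *Hodge cycles on abelian varieties*, LNM 900 (1982), I §3 and §5 Prop. 5.1.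
* [DeligneMilne1982Tannakian] P. Deligne, J. S. Milne, *Tannakian Categories*, LNM 900 (1982), II Thm. 6.20 (Riemann).
-/

noncomputable section

open CategoryTheory CategoryTheory.Limits Module

universe u

namespace Summit.HodgeConjecture.CorCM

open Literature.AlgebraicGeometry.Motives
open Literature.AlgebraicGeometry.Motives.AbelianVariety
open Literature.AlgebraicGeometry.Motives.HodgeStructure
open Literature.AlgebraicGeometry.HodgeTheory
open Literature.AlgebraicGeometry.ComplexMultiplication (bettiRep bettiRep_injective nontrivial_endAlgebra_of_dim_pos
  isIsogenous_biproduct_powSucc)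
open Literature.AlgebraicGeometry.Milne1999 (IsOfCMType isOfCMType_iff_of_isIsogenous)

/-! ## §1 The corner of `End⁰` along a quasi-retraction (any base field) -/

section Corner

variable {K : Type u} [Field K] {X Y : AbelianVariety K} {h : X ⟶ Y} {i : Y ⟶ X} {M : ℕ} {e : X.endAlgebra}

omit [Field K] in
/-- Every element of `End⁰(A) = ℚ ⊗ End A` is `a⁻¹ · F` with `a ≥ 1` and `F ∈ End A`
(`endAlgebra.exists_eq_algebraMap_mul_of`, in scalar-multiplication form). [cite: MumfordAV1970, §19 (p. 172, End⁰)] -/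
theorem endAlgebra_exists_eq_inv_smul_of [Field K] {A : AbelianVariety K} (x : A.endAlgebra) :
    ∃ (a : ℕ) (F : End A), a ≠ 0 ∧ x = ((a : ℚ)⁻¹) • endAlgebra.of A F := by
  obtain ⟨a, F, ha, rfl⟩ := endAlgebra.exists_eq_algebraMap_mul_of x
  exact ⟨a, F, ha, (Algebra.smul_def _ _).symm⟩

/-- `endConjLin i h (c · G) = c · (h ≫ G ≫ i)`. [cite: MumfordAV1970, §19 Remark p. 169] -/
theorem endConjLin_smul_of (i : Y ⟶ X) (h : X ⟶ Y) (c : ℚ) (G : End Y) :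
    endConjLin i h (c • endAlgebra.of Y G) = c • endAlgebra.of X (endConj i h G) := by
  rw [map_smul, endConjLin_of]

/-- **The corner of `End⁰` along a quasi-retraction.**  Let `h : X → Y`, `i : Y → X` be homomorphisms of abelian
varieties with `i h = [M]_Y` (`M ≥ 1`) and `h i = F` where `F = M e` in `End⁰(X)` for a CENTRAL idempotent `e` of
`End⁰(X)`.  Then `θ : End⁰(Y) → End⁰(X)`, `w' ↦ i w' h` (`endConjLin i h`), is injective, satisfies `e θ(w') = θ(w')`,
is onto the corner `{w : e w = w}`, is multiplicative up to `M` (`θ(x) θ(y) = M θ(xy)`) and `θ(1) = M e`.  (Proof: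
`θ(1) = h i = F = M e`; `θ(x)θ(y) = i x h i y h = M i x y h`; if `θ(w') = 0` then `M² w' = h θ(w') i = 0`; and for
`e w = w`, `θ(M⁻² · h w i) = M⁻² F w F = e w e = e w = w`.) [cite: MumfordAV1970, §19 Remark p. 169 and Thm. 1 (p. 173)] -/
theorem corner_transport (hM : M ≠ 0) (hih : i ≫ h = M • 𝟙 Y) (hec : e ∈ Subalgebra.center ℚ X.endAlgebra)
    (hee : e * e = e) (hFe : endAlgebra.of X (End.of (h ≫ i)) = algebraMap ℚ X.endAlgebra (M : ℚ) * e) :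
    Function.Injective (endConjLin i h) ∧
      (∀ w', e * endConjLin i h w' = endConjLin i h w') ∧
      (∀ w, e * w = w → ∃ w', endConjLin i h w' = w) ∧
      (∀ x y, endConjLin i h x * endConjLin i h y = (M : ℚ) • endConjLin i h (x * y)) ∧
      endConjLin i h 1 = (M : ℚ) • e := by
  have hM' : (M : ℚ) ≠ 0 := Nat.cast_ne_zero.2 hM
  have hcomm : ∀ w : X.endAlgebra, w * e = e * w := fun w => Subalgebra.mem_center_iff.1 hec w
  have hFe' : endAlgebra.of X (End.of (h ≫ i)) = (M : ℚ) • e := by rw [hFe, Algebra.smul_def]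
  -- `θ(1) = M e`
  have hone : endConjLin i h 1 = (M : ℚ) • e := by
    rw [← map_one (endAlgebra.of Y), endConjLin_of, endConj_apply, ← hFe']
    change endAlgebra.of X (End.of (h ≫ 𝟙 Y ≫ i)) = _
    rw [Category.id_comp]
  -- `θ(x) θ(y) = M θ(xy)`
  have hmul : ∀ x y, endConjLin i h x * endConjLin i h y = (M : ℚ) • endConjLin i h (x * y) := by
    intro x y
    obtain ⟨a, F, -, rfl⟩ := endAlgebra_exists_eq_inv_smul_of x
    obtain ⟨b, G, -, rfl⟩ := endAlgebra_exists_eq_inv_smul_of y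
    have hxy : ((a : ℚ)⁻¹ • endAlgebra.of Y F) * ((b : ℚ)⁻¹ • endAlgebra.of Y G) =
        ((a : ℚ)⁻¹ * (b : ℚ)⁻¹) • endAlgebra.of Y (F * G) := by
      rw [smul_mul_smul_comm, map_mul]
    rw [hxy, endConjLin_smul_of, endConjLin_smul_of, endConjLin_smul_of, smul_mul_smul_comm,
      ← map_mul (endAlgebra.of X), endConj_mul hih, map_nsmul, ← Nat.cast_smul_eq_nsmul ℚ, smul_smul, smul_smul,
      mul_comm (M : ℚ)]
  -- `e θ(w') = θ(w')`
  have hfix : ∀ w', e * endConjLin i h w' = endConjLin i h w' := by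
    intro w'
    apply smul_right_injective X.endAlgebra hM'
    change (M : ℚ) • (e * endConjLin i h w') = (M : ℚ) • endConjLin i h w'
    rw [← smul_mul_assoc, ← hone, hmul, one_mul]
  refine ⟨?_, hfix, ?_, hmul, hone⟩
  · -- injective
    rw [injective_iff_map_eq_zero]
    intro w' hw'
    obtain ⟨a, G, ha, rfl⟩ := endAlgebra_exists_eq_inv_smul_of w'
    rw [endConjLin_smul_of, smul_eq_zero] at hw'
    rcases hw' with h0 | h0
    · exact absurd h0 (inv_ne_zero (Nat.cast_ne_zero.2 ha))
    · have h1 : endConjLin h i (endAlgebra.of X (endConj i h G)) = 0 := by rw [h0, map_zero]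
      rw [endConjLin_of, endConj_endConj hih, map_nsmul, ← Nat.cast_smul_eq_nsmul ℚ, smul_eq_zero] at h1
      rcases h1 with h1 | h1
      · exact absurd h1 (by exact_mod_cast mul_ne_zero hM hM)
      · rw [h1, smul_zero]
  · -- onto the corner
    intro w hw
    obtain ⟨a, G, ha, rfl⟩ := endAlgebra_exists_eq_inv_smul_of w
    refine ⟨((a : ℚ)⁻¹ * ((M : ℚ) * M)⁻¹) • endAlgebra.of Y (endConj h i G), ?_⟩
    have hcomp : endConj i h (endConj h i G) = End.of (h ≫ i) * G * End.of (h ≫ i) := by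
      rw [endConj_apply, endConj_apply]
      simp only [End.mul_def, End.of, End.asHom, Category.assoc]
    have heG : e * endAlgebra.of X G = endAlgebra.of X G := by
      rw [mul_smul_comm] at hw
      exact smul_right_injective X.endAlgebra (inv_ne_zero (Nat.cast_ne_zero.2 ha)) hw
    have hMeG : ((M : ℚ) • e) * endAlgebra.of X G * ((M : ℚ) • e) = ((M : ℚ) * M) • endAlgebra.of X G := by
      rw [smul_mul_assoc, smul_mul_smul_comm, mul_assoc, hcomm (endAlgebra.of X G), ← mul_assoc, hee, heG]
    rw [endConjLin_smul_of, hcomp, map_mul, map_mul, hFe', hMeG, smul_smul, mul_assoc,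
      inv_mul_cancel₀ (mul_ne_zero hM' hM'), mul_one]

/-- **The centre of `End⁰(Y)` is `ℚ` when the centre of the corner is `ℚ e`**: in the situation of `corner_transport`, if
every `w` with `e w = w` commuting with all such elements is a rational multiple of `e`, then `Z(End⁰ Y) = ℚ` (a central
`w'` has `θ(w')` central in the corner `θ(End⁰ Y) = e End⁰(X)`, so `θ(w') = c e = θ((c/M) · 1)`, and `θ` is injective).
[cite: MumfordAV1970, §19 Remark p. 169 and Cor. 2 (p. 174)] -/
theorem center_eq_bot_of_corner (hM : M ≠ 0) (hih : i ≫ h = M • 𝟙 Y) (hec : e ∈ Subalgebra.center ℚ X.endAlgebra)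
    (hee : e * e = e) (hFe : endAlgebra.of X (End.of (h ≫ i)) = algebraMap ℚ X.endAlgebra (M : ℚ) * e)
    (hcen : ∀ w : X.endAlgebra, e * w = w → (∀ w' : X.endAlgebra, e * w' = w' → w * w' = w' * w) →
      ∃ c : ℚ, w = c • e) :
    Subalgebra.center ℚ Y.endAlgebra = ⊥ := by
  have hM' : (M : ℚ) ≠ 0 := Nat.cast_ne_zero.2 hM
  obtain ⟨hinj, hfix, hsurj, hmul, hone⟩ := corner_transport hM hih hec hee hFe
  refine le_antisymm (fun w' hw' => ?_) bot_le
  rw [Subalgebra.mem_center_iff] at hw'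
  obtain ⟨c, hc⟩ := hcen (endConjLin i h w') (hfix w') (fun u hu => by
    obtain ⟨u', rfl⟩ := hsurj u hu
    rw [hmul, hmul, hw' u'])
  refine Algebra.mem_bot.2 ⟨c / M, hinj ?_⟩
  rw [Algebra.algebraMap_eq_smul_one, map_smul, hone, hc, smul_smul, div_mul_cancel₀ c hM']

end Corner

/-! ## §2 The isogeny classification: semisimple rank one, in particular Mumford–Tate rank `≤ 6` -/

section RankSix

variable [HodgeTensorFacts.{0, 0}] {X : AbelianVariety ℂ} {n : ℕ}

omit [HodgeTensorFacts.{0, 0}] in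
/-- **The non-CM part from the corner data.**  Let `h : X → Y`, `i : Y → X` with `i h = [M]_Y`, `h i = F = M e` for a
central idempotent `e` of `End⁰(X)` whose corner `e End⁰(X)` has dimension `(rk e^*)²/4` and centre `ℚ e`, with
`i^* h^* = M`, `h^* i^* = M e^*` on `H¹` and `Y` not of CM type.  Then `End⁰(Y)` is the corner (`corner_transport`), of
dimension `(dim Y)²` with centre `ℚ`, so `Y ∼ B^{m+1}` with `B` SIMPLE, `0 < dim B ≤ 2`, NOT of CM type,
`dim End⁰(B) = (dim B)²`, `Z(End⁰ B) = ℚ`, `dim Y = (m+1) dim B`, and `rk e^* = 2 dim Y`.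
[cite: MoonenZarhin1999LowDim, §2 (2.1)–(2.5)] [cite: MumfordAV1970, §19 Thm. 1, Cor. 1–2 (pp. 173–174)] -/
theorem exists_isIsogenous_power_of_corner_data {Y : AbelianVariety ℂ} {h : X ⟶ Y} {i : Y ⟶ X} {M : ℕ}
    {e : X.endAlgebra} (hM : M ≠ 0) (hih : i ≫ h = M • 𝟙 Y) (hec : e ∈ Subalgebra.center ℚ X.endAlgebra)
    (hee : e * e = e) (hFe : endAlgebra.of X (End.of (h ≫ i)) = algebraMap ℚ X.endAlgebra (M : ℚ) * e)
    (hdim : ∀ K : Submodule ℚ X.endAlgebra, (∀ w, w ∈ K ↔ e * w = w) →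
      4 * Module.finrank ℚ K = Module.finrank ℚ (LinearMap.range (MulOpposite.unop (bettiRep X e))) ^ 2)
    (hcen : ∀ w : X.endAlgebra, e * w = w → (∀ w' : X.endAlgebra, e * w' = w' → w * w' = w' * w) → ∃ c : ℚ, w = c • e)
    (hx0 : 0 < Module.finrank ℚ (LinearMap.range (MulOpposite.unop (bettiRep X e))))
    (h1 : (bettiCohomology.map i.hom.hom.hom 1).hom ∘ₗ (bettiCohomology.map h.hom.hom.hom 1).hom =
      (M : ℚ) • LinearMap.id)
    (h2 : (bettiCohomology.map h.hom.hom.hom 1).hom ∘ₗ (bettiCohomology.map i.hom.hom.hom 1).hom =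
      (M : ℚ) • MulOpposite.unop (bettiRep X e))
    (hYcm : ¬ IsOfCMType Y) :
    ∃ (B : AbelianVariety ℂ) (m : ℕ), B.IsSimple ∧ 0 < B.dim ∧ B.dim ≤ 2 ∧ ¬ IsOfCMType B ∧
      Module.finrank ℚ B.endAlgebra = B.dim ^ 2 ∧ Module.finrank ℚ (Subalgebra.center ℚ B.endAlgebra) = 1 ∧
      IsIsogenous Y (⨁ fun _ : Fin (m + 1) => B) ∧ Y.dim = (m + 1) * B.dim ∧
      Module.finrank ℚ (LinearMap.range (MulOpposite.unop (bettiRep X e))) = 2 * Y.dim := by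
  haveI := BettiUniverse.finite (AbelianVariety.isSmoothProjective_holds (A := X)) 1
  have hM' : (M : ℚ) ≠ 0 := Nat.cast_ne_zero.2 hM
  obtain ⟨hinj, hfix, hsurj, -, -⟩ := corner_transport hM hih hec hee hFe
  -- the corner `e End⁰(X)` is the image of `θ`
  have hK : ∀ w, w ∈ LinearMap.range (endConjLin i h) ↔ e * w = w := fun w =>
    ⟨fun ⟨w', hw'⟩ => hw' ▸ hfix w', fun hw => hsurj w hw⟩
  have hdimK := hdim _ hK
  rw [LinearMap.finrank_range_of_inj hinj] at hdimK
  -- `rk e^* = dim H¹(Y) = 2 dim Y`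
  set p : Module.End ℚ (bettiCohomology X.X 1) := MulOpposite.unop (bettiRep X e) with hpdef
  set iS := (bettiCohomology.map i.hom.hom.hom 1).hom with hiS
  set hS := (bettiCohomology.map h.hom.hom.hom 1).hom with hhS
  have hSinj : Function.Injective hS := by
    intro a b hab
    have hab' := congrArg iS hab
    rw [← LinearMap.comp_apply, ← LinearMap.comp_apply, h1, LinearMap.smul_apply, LinearMap.smul_apply,
      LinearMap.id_apply, LinearMap.id_apply] at hab'
    exact smul_right_injective _ hM' hab'
  have hrange : LinearMap.range p = LinearMap.range hS := by
    apply le_antisymm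
    · rintro _ ⟨v, rfl⟩
      refine ⟨(M : ℚ)⁻¹ • iS v, ?_⟩
      rw [LinearMap.map_smul, ← LinearMap.comp_apply, h2, LinearMap.smul_apply, smul_smul, inv_mul_cancel₀ hM', one_smul]
    · rintro _ ⟨y, rfl⟩
      refine ⟨hS y, smul_right_injective _ hM' ?_⟩
      change (M : ℚ) • p (hS y) = (M : ℚ) • hS y
      calc (M : ℚ) • p (hS y) = ((M : ℚ) • p) (hS y) := rfl
        _ = hS (iS (hS y)) := by rw [← h2]; rfl
        _ = hS (((M : ℚ) • LinearMap.id : Module.End ℚ _) y) := by rw [← h1]; rfl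
        _ = (M : ℚ) • hS y := by rw [LinearMap.smul_apply, LinearMap.id_apply, LinearMap.map_smul]
  have hx2 : Module.finrank ℚ (LinearMap.range p) = 2 * Y.dim := by
    rw [hrange, LinearMap.finrank_range_of_inj hSinj, finrank_bettiCohomology_one]
  have hY0 : 0 < Y.dim := by omega
  have hfinY : Module.finrank ℚ Y.endAlgebra = Y.dim ^ 2 := by
    rw [hx2] at hdimK
    have h' : 4 * Module.finrank ℚ Y.endAlgebra = 4 * Y.dim ^ 2 := by rw [hdimK]; ring
    exact Nat.eq_of_mul_eq_mul_left (by norm_num) h'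
  -- `Z(End⁰ Y) = ℚ`
  have hcY1 : Module.finrank ℚ (Subalgebra.center ℚ Y.endAlgebra) = 1 := by
    haveI := nontrivial_endAlgebra_of_dim_pos (B := Y) hY0
    rw [center_eq_bot_of_corner hM hih hec hee hFe hcen, Subalgebra.finrank_bot]
  -- `Y ∼ B^{m+1}`
  obtain ⟨B, m, hBs, hB0, hYB, hdimY, hfinYB, hZB⟩ := exists_isIsogenous_power_of_finrank_center_eq_one hcY1
  have hfinB : Module.finrank ℚ B.endAlgebra = B.dim ^ 2 := by
    rw [hfinY, hdimY] at hfinYB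
    have h' : (m + 1) ^ 2 * Module.finrank ℚ B.endAlgebra = (m + 1) ^ 2 * B.dim ^ 2 := by rw [← hfinYB]; ring
    exact Nat.eq_of_mul_eq_mul_left (by positivity) h'
  have hB2 : B.dim ≤ 2 := dim_le_two_of_finrank_endAlgebra_eq_sq hBs hB0 hfinB
  have hBcm : ¬ IsOfCMType B := fun hBcm => hYcm (by
    rw [isOfCMType_iff_of_isIsogenous hYB, CMProductEnd.isOfCMType_biproduct_fin_iff]
    exact fun _ => hBcm)
  exact ⟨B, m, hBs, hB0, hB2, hBcm, hfinB, hZB, hYB, hdimY, hx2⟩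

/-- **Structure theorem for complex abelian varieties whose Hodge group has semisimple rank one**
(`dim [Lie Hg(H¹X), Lie Hg(H¹X)] = 3`, any centre; e.g. `X` NOT of CM type with `dim MT(H¹(X)) ≤ 6`).  Such an `X` is
isogenous to `B^{m+1} × Z` with `B` SIMPLE, `0 < dim B ≤ 2`, NOT of CM type, `dim_ℚ End⁰(B) = (dim B)²`,
`Z(End⁰ B) = ℚ` (a non-CM elliptic curve or an abelian surface with quaternionic multiplication — Hodge group `SL₂`),
and `Z` of CM type (possibly `0`); `(m+1) dim B + dim Z = dim X`, and `dim Z = 0` exactly in Mumford–Tate rank `4`.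
PROOF: the splitting `X ∼ Y × Z` of `exists_quasiRetraction_splitting_of_finrank_derived_eq_three` and
`exists_isIsogenous_power_of_corner_data`.
[cite: MoonenZarhin1999LowDim, §2 (2.1)–(2.5)] [cite: MumfordAV1970, §19 Thm. 1, Cor. 1–2 (pp. 173–174)]
[cite: Deligne1982HodgeCycles, I §5 Prop. 5.1] -/
theorem exists_isIsogenous_powSucc_prod_of_finrank_derived_eq_three (hX : IsSmoothProjective n X.X) (h0 : 0 < X.dim)
    (h3 : haveI := BettiUniverse.finite hX 1
      Module.finrank ℚ ↥(Submodule.span ℚ {B | ∃ X' ∈ (BettiUniverse.hodge exists_isReal_hodgeModel_holds hX 1).hodgeLie,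
        ∃ Y ∈ (BettiUniverse.hodge exists_isReal_hodgeModel_holds hX 1).hodgeLie, X' * Y - Y * X' = B}) = 3) :
    haveI := BettiUniverse.finite hX 1
    ∃ (B Z : AbelianVariety ℂ) (m : ℕ), B.IsSimple ∧ 0 < B.dim ∧ B.dim ≤ 2 ∧ ¬ IsOfCMType B ∧
      Module.finrank ℚ B.endAlgebra = B.dim ^ 2 ∧ Module.finrank ℚ (Subalgebra.center ℚ B.endAlgebra) = 1 ∧
      IsOfCMType Z ∧ IsIsogenous X ((B.powSucc m).prod Z) ∧ (m + 1) * B.dim + Z.dim = X.dim ∧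
      (Z.dim = 0 ↔ (BettiUniverse.hodge exists_isReal_hodgeModel_holds hX 1).mtRank = 4) := by
  have hn : X.dim = n := schemeDim_eq_holds hX
  subst hn
  haveI := BettiUniverse.finite hX 1
  obtain ⟨e, M, F, Y, Z, h, i, t, j, hec, hee, -, he1, hM, hFe, -, hhi, hih, -, -, -, -, hiso, hdimYZ, hZcm, hYcm, hdim,
    hcen, hxy, hx0, h1, h2, -, -, -, -⟩ := exists_quasiRetraction_splitting_of_finrank_derived_eq_three hX h0 h3
  have hFe' : endAlgebra.of X (End.of (h ≫ i)) = algebraMap ℚ X.endAlgebra (M : ℚ) * e := by rw [hhi]; exact hFe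
  obtain ⟨B, m, hBs, hB0, hB2, hBcm, hfinB, hZB, hYB, hdimY, hx2⟩ :=
    exists_isIsogenous_power_of_corner_data hM hih hec hee hFe' hdim hcen hx0 h1 h2 hYcm
  -- `X ∼ Y ⊞ Z ≅ Y × Z ∼ B^{m+1} × Z`
  have hXYZ : IsIsogenous X ((B.powSucc m).prod Z) := by
    have h1' : IsIsogenous (Y ⊞ Z) X := ⟨_, hiso⟩
    have h2' : IsIsogenous (Y ⊞ Z) (Y.prod Z) := ⟨(biprodIsoProd Y Z).hom, isIsogeny_hom_of_iso _⟩
    have h3' : IsIsogenous (Y.prod Z) ((B.powSucc m).prod Z) :=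
      (hYB.trans (isIsogenous_biproduct_powSucc B m)).prod (IsIsogenous.refl Z)
    exact h1'.symm'.trans (h2'.trans h3')
  refine ⟨B, Z, m, hBs, hB0, hB2, hBcm, hfinB, hZB, hZcm, hXYZ, by rw [← hdimY]; exact hdimYZ, ?_⟩
  -- `dim Z = 0 ↔ e = 1 ↔ dim MT = 4`
  rw [← he1]
  set p : Module.End ℚ (bettiCohomology X.X 1) := MulOpposite.unop (bettiRep X e) with hpdef
  have hy : Module.finrank ℚ (LinearMap.ker p) = 2 * Z.dim := by omega
  have hpp : p * p = p := by rw [hpdef, ← MulOpposite.unop_mul, ← map_mul, hee]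
  constructor
  · intro hZ0
    have hker : LinearMap.ker p = ⊥ := by rw [← Submodule.finrank_eq_zero, hy, hZ0, mul_zero]
    have hp1 : p = 1 := by
      ext v
      have hv : p (p v - v) = 0 := by rw [map_sub, ← Module.End.mul_apply, hpp, sub_self]
      rw [← LinearMap.mem_ker, hker, Submodule.mem_bot, sub_eq_zero] at hv
      rw [Module.End.one_apply]
      exact hv
    apply bettiRep_injective
    apply MulOpposite.unop_injective
    rw [← hpdef, hp1, map_one, MulOpposite.unop_one]
  · intro he
    have hp1 : p = 1 := by rw [hpdef, he, map_one, MulOpposite.unop_one]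
    have h' := hy
    rw [hp1, Module.End.one_eq_id, LinearMap.ker_id, finrank_bot] at h'
    omega

/-- **The same with the dichotomy for the non-CM factor spelled out**: `B` is a non-CM elliptic curve with `End⁰(B) = ℚ`,
or an abelian surface with `End⁰(B)` a NON-COMMUTATIVE central `ℚ`-algebra of dimension `4` (an indefinite quaternion
algebra: quaternionic multiplication). [cite: MoonenZarhin1999LowDim, §2 (2.1)–(2.3)]
[cite: MumfordAV1970, §19 Cor. 2 (p. 174) and §21] -/
theorem exists_isIsogenous_powSucc_prod_dim_le_two_of_finrank_derived_eq_three (hX : IsSmoothProjective n X.X)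
    (h0 : 0 < X.dim)
    (h3 : haveI := BettiUniverse.finite hX 1
      Module.finrank ℚ ↥(Submodule.span ℚ {B | ∃ X' ∈ (BettiUniverse.hodge exists_isReal_hodgeModel_holds hX 1).hodgeLie,
        ∃ Y ∈ (BettiUniverse.hodge exists_isReal_hodgeModel_holds hX 1).hodgeLie, X' * Y - Y * X' = B}) = 3) :
    ∃ (B Z : AbelianVariety ℂ) (m : ℕ), B.IsSimple ∧ ¬ IsOfCMType B ∧ IsOfCMType Z ∧
      IsIsogenous X ((B.powSucc m).prod Z) ∧ (m + 1) * B.dim + Z.dim = X.dim ∧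
      Module.finrank ℚ (Subalgebra.center ℚ B.endAlgebra) = 1 ∧
      ((B.dim = 1 ∧ Module.finrank ℚ B.endAlgebra = 1) ∨
        (B.dim = 2 ∧ Module.finrank ℚ B.endAlgebra = 4 ∧ ¬ ∀ x y : B.endAlgebra, x * y = y * x)) := by
  obtain ⟨B, Z, m, hBs, hB0, hB2, hBcm, hfinB, hZB, hZcm, hXYZ, hdims, -⟩ :=
    exists_isIsogenous_powSucc_prod_of_finrank_derived_eq_three hX h0 h3
  refine ⟨B, Z, m, hBs, hBcm, hZcm, hXYZ, hdims, hZB, ?_⟩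
  rcases (show B.dim = 1 ∨ B.dim = 2 by omega) with h1 | h2
  · left
    rw [h1] at hfinB
    exact ⟨h1, by simpa using hfinB⟩
  · right
    rw [h2] at hfinB
    refine ⟨h2, by simpa using hfinB, not_comm_endAlgebra_of_finrank_center_lt ?_⟩
    rw [hZB, hfinB]
    norm_num

/-- **Structure theorem for complex abelian varieties NOT of CM type with `dim MT(H¹(X)) ≤ 6`** (then
`dim [Lie Hg, Lie Hg] = 3`, `finrank_derived_eq_three_of_mtRank_le_six`): `X ∼ B^{m+1} × Z` as in
`exists_isIsogenous_powSucc_prod_of_finrank_derived_eq_three`. [cite: MoonenZarhin1999LowDim, §2 (2.1)–(2.5)]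
[cite: MumfordAV1970, §19 Thm. 1, Cor. 1–2 (pp. 173–174)] -/
theorem exists_isIsogenous_powSucc_prod_of_mtRank_le_six (hX : IsSmoothProjective n X.X) (h0 : 0 < X.dim)
    (hcm : ¬ IsOfCMType X)
    (h6 : haveI := BettiUniverse.finite hX 1
      (BettiUniverse.hodge exists_isReal_hodgeModel_holds hX 1).mtRank ≤ 6) :
    haveI := BettiUniverse.finite hX 1
    ∃ (B Z : AbelianVariety ℂ) (m : ℕ), B.IsSimple ∧ 0 < B.dim ∧ B.dim ≤ 2 ∧ ¬ IsOfCMType B ∧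
      Module.finrank ℚ B.endAlgebra = B.dim ^ 2 ∧ Module.finrank ℚ (Subalgebra.center ℚ B.endAlgebra) = 1 ∧
      IsOfCMType Z ∧ IsIsogenous X ((B.powSucc m).prod Z) ∧ (m + 1) * B.dim + Z.dim = X.dim ∧
      (Z.dim = 0 ↔ (BettiUniverse.hodge exists_isReal_hodgeModel_holds hX 1).mtRank = 4) :=
  exists_isIsogenous_powSucc_prod_of_finrank_derived_eq_three hX h0 (finrank_derived_eq_three_of_mtRank_le_six hX h0 hcm h6).1

/-- The dichotomy for the non-CM factor, for `X` NOT of CM type with `dim MT(H¹(X)) ≤ 6`.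
[cite: MoonenZarhin1999LowDim, §2 (2.1)–(2.3)] [cite: MumfordAV1970, §19 Cor. 2 (p. 174) and §21] -/
theorem exists_isIsogenous_powSucc_prod_dim_le_two_of_mtRank_le_six (hX : IsSmoothProjective n X.X) (h0 : 0 < X.dim)
    (hcm : ¬ IsOfCMType X)
    (h6 : haveI := BettiUniverse.finite hX 1
      (BettiUniverse.hodge exists_isReal_hodgeModel_holds hX 1).mtRank ≤ 6) :
    ∃ (B Z : AbelianVariety ℂ) (m : ℕ), B.IsSimple ∧ ¬ IsOfCMType B ∧ IsOfCMType Z ∧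
      IsIsogenous X ((B.powSucc m).prod Z) ∧ (m + 1) * B.dim + Z.dim = X.dim ∧
      Module.finrank ℚ (Subalgebra.center ℚ B.endAlgebra) = 1 ∧
      ((B.dim = 1 ∧ Module.finrank ℚ B.endAlgebra = 1) ∨
        (B.dim = 2 ∧ Module.finrank ℚ B.endAlgebra = 4 ∧ ¬ ∀ x y : B.endAlgebra, x * y = y * x)) :=
  exists_isIsogenous_powSucc_prod_dim_le_two_of_finrank_derived_eq_three hX h0
    (finrank_derived_eq_three_of_mtRank_le_six hX h0 hcm h6).1

end RankSix

end Summit.HodgeConjecture.CorCM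

end
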